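/-
Copyright (c) 2026. All rights reserved.
Released under Apache 2.0 license as described in the file LICENSE.
Authors: abc-iut cell, wave-5 prover seat abc-iut-w5-d172 (proof-only; over abc-iut-S1's `LocalUnitLog` /
`LogSeriesEstimates` / `RamificationInvariants`).
-/
import Literature.IUT.LogVolume.LogSeriesEstimates
import Literature.IUT.LogVolume.RamificationInvariants
import HarnessLib

/-!
# `log_p(𝒪_K^×) ⊆ 𝔪_K` at absolute ramification `e ≤ p − 1`: the logarithm of a unit is never a unit

Classical (Koblitz, *p-adic Numbers, p-adic Analysis, and Zeta-Functions*, GTM 58, Ch. IV §1;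
Neukirch, *Algebraic Number Theory*, Ch. II (5.5)): for a finite extension `K/ℚ_p` with absolute
ramification index `e`, every principal unit `y ∈ 1 + 𝔪_K` has `‖1 − y‖ ≤ ‖ϖ‖ = p^{−1/e}`, and the
logarithmic series is `1`-Lipschitz on the ball `‖1 − y‖ ≤ ρ` as soon as `ρ · p^{1/(p−1)} ≤ 1`; for
`ρ = p^{−1/e}` this is exactly the condition **`e ≤ p − 1`** (all UNRAMIFIED `K`, `p = 2` included, and
e.g. `ℚ_p(ζ_p)`).  Consequently `‖log_p u‖ ≤ p^{−1/e} < 1` for EVERY unit `u` (reduce to a principal power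
`u^m` with `p ∤ m`, so that `‖m‖ = 1`): `log_p(𝒪_K^×) ⊆ 𝔪_K`, no element of `log_p(𝒪_K^×)` is a unit, and the
"second iterate" of `log_p` on units — `log_p` applied to those units which are logarithms of units — has
EMPTY domain.

PROOF-ONLY file (no definitions) in the norm-side MLF setting of `LocalUnitLog.lean`
(`[NormedAlgebra ℚ_[p] K] [IsUltrametricDist K] [ProperSpace K]`), for abc-iut-S1's REAL logarithm
`unitLog = log_p`:

* `norm_unitLog_le_of_forall_isPrincipal` / `norm_unitLog_lt_one_of_forall_isPrincipal` — the abstract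
  form: if every principal unit satisfies `‖1 − y‖ ≤ ρ` with `ρ · p^{1/(p−1)} ≤ 1`, then `‖log_p u‖ ≤ ρ` and
  `‖log_p u‖ < 1` for every `u`;
* `rpow_absRamificationIdx_mul_rpow_le_one` — `p^{−1/e} · p^{1/(p−1)} ≤ 1 ↔`-direction used: `e ≤ p − 1`
  suffices;
* **`norm_unitLog_le_rpow_of_absRamificationIdx_le`**, **`norm_unitLog_lt_one_of_absRamificationIdx_le`**
  — for `e ≤ p − 1`: `‖log_p u‖ ≤ p^{−1/e}` and `‖log_p u‖ < 1` for every `u : K`;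
* `logUnits_subset_ball_of_absRamificationIdx_le` — `log_p(𝒪_K^×) ⊆ 𝔪_K = ball 0 1`;
  `norm_ne_one_of_mem_logUnits`, `logUnits_inter_sphere_eq_empty`,
  `unitLog_image_logUnits_inter_sphere_eq_empty` — no logarithm of a unit is a unit; the second iterate of
  `log_p` on units has empty image;
* `norm_unitLog_lt_one_of_absRamificationIdx_eq_one` — the unramified case `e = 1` (every `p`).

The sharper EQUALITY `log_p(𝒪_K^×) = 𝔪_K` for `p > 2`, `e ≤ p − 2` ([IUTchIV] Prop. 1.2 (i)) is abc-iut-S1's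
`prop12iEq_holds` / `Literature.IUT.LogThetaLattice.logUnits_eq_closedBall_of_absRamificationIdx_le`; the
present file only adds the INCLUSION on the closed range `e ≤ p − 1` (boundary cases `e = p − 1` and
`p = 2, e = 1`, where the equality CAN fail: `log(ℤ_2^×) = 4ℤ_2 ⊊ 2ℤ_2`, and `log_p(𝒪^×) ⊊ 𝔪` for `ℚ_p(ζ_p)`;
it need not fail — e.g. `ℚ_3(√3)`, `e = 2 = p − 1`, has `log_3(𝒪^×) = 𝔪`, audit note N-w5d136-3).  Consumer:
the abc-iut cell's honest model of the [IUTchIII] log-link iterates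
(`Summits/ABC/IUTFork/Cor312Ind3IteratesVacuity.lean` over `Cor312Ind3RealIterates.lean`), where it shows that
the depth-`≥ 2` iterate images of units are empty at every place of small ramification.
Nothing here is disputed mathematics and nothing bears on [IUTchIII] Cor. 3.12.
-/

noncomputable section

open Metric Set

namespace Literature.IUT.LogVolume

open Literature.NumberTheory.Transcendental

variable (p : ℕ) [Fact p.Prime]
variable {K : Type*} [NontriviallyNormedField K] [instK : NormedAlgebra ℚ_[p] K] [IsUltrametricDist K]
  [ProperSpace K]

/-! ## The abstract form: a Lipschitz radius containing all principal units -/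

omit [IsUltrametricDist K] [ProperSpace K] in
/-- In a normed `ℚ_p`-algebra, a natural number prime to `p` has norm `1`.
[cite: Koblitz1984, Ch. I §2] -/
theorem norm_natCast_eq_one_of_not_dvd {m : ℕ} (hm : ¬ p ∣ m) : ‖(m : K)‖ = 1 := by
  rw [norm_natCast_eq_padicNorm p K m, Padic.norm_natCast_eq_one_iff]
  exact (Nat.Prime.coprime_iff_not_dvd Fact.out).mpr hm

/-- **Abstract form.** If every principal unit `y` (`‖1 − y‖ < 1`) of `K` satisfies `‖1 − y‖ ≤ ρ` for a
radius with `ρ · p^{1/(p−1)} ≤ 1` (the Lipschitz range of the logarithmic series), then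
`‖log_p u‖ ≤ ρ` for every `u : K`: for a unit, `log_p u = m⁻¹ · L(u^m)` with `u^m` principal and `p ∤ m`
(`exists_pow_isPrincipal_not_dvd`), `‖m⁻¹‖ = 1` and `‖L(u^m)‖ ≤ ‖1 − u^m‖ ≤ ρ`
(`norm_logSeries_le_norm`); for a non-unit `log_p u = 0` (junk value) and `0 ≤ ρ` from `y = 1`.
[cite: Koblitz1984, Ch. IV §1] -/
theorem norm_unitLog_le_of_forall_isPrincipal {ρ : ℝ} (hθ : ρ * (p : ℝ) ^ (1 / ((p : ℝ) - 1)) ≤ 1)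
    (hρ : ∀ y : K, IsPrincipal y → ‖1 - y‖ ≤ ρ) (u : K) : ‖unitLog u‖ ≤ ρ := by
  have hρ0 : 0 ≤ ρ := by
    have h1 := hρ 1 (by rw [isPrincipal_iff, sub_self, norm_zero]; exact one_pos)
    rwa [sub_self, norm_zero] at h1
  by_cases hu : ‖u‖ = 1
  · obtain ⟨m, hm0, hmp, hmP⟩ := exists_pow_isPrincipal_not_dvd (p := p) hu
    rw [unitLog_eq_inv_mul_logSeries p hm0 hmP, norm_mul, norm_inv,
      norm_natCast_eq_one_of_not_dvd p hmp, inv_one, one_mul]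
    exact (norm_logSeries_le_norm p K hθ (hρ _ hmP)).trans (hρ _ hmP)
  · rw [unitLog_of_norm_ne_one hu, norm_zero]
    exact hρ0

/-- **Abstract form, strict.** Under the same hypotheses `‖log_p u‖ < 1` for every `u : K`
(`‖L(u^m)‖ ≤ ‖1 − u^m‖ < 1`). [cite: Koblitz1984, Ch. IV §1] -/
theorem norm_unitLog_lt_one_of_forall_isPrincipal {ρ : ℝ} (hθ : ρ * (p : ℝ) ^ (1 / ((p : ℝ) - 1)) ≤ 1)
    (hρ : ∀ y : K, IsPrincipal y → ‖1 - y‖ ≤ ρ) (u : K) : ‖unitLog u‖ < 1 := by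
  by_cases hu : ‖u‖ = 1
  · obtain ⟨m, hm0, hmp, hmP⟩ := exists_pow_isPrincipal_not_dvd (p := p) hu
    rw [unitLog_eq_inv_mul_logSeries p hm0 hmP, norm_mul, norm_inv,
      norm_natCast_eq_one_of_not_dvd p hmp, inv_one, one_mul]
    exact (norm_logSeries_le_norm p K hθ (hρ _ hmP)).trans_lt hmP
  · rw [unitLog_of_norm_ne_one hu, norm_zero]
    exact one_pos

/-! ## The ramification form: `e ≤ p − 1` -/

/-- Every principal unit satisfies `‖1 − y‖ ≤ p^{−1/e}` (discreteness of the norm: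
`norm_le_rpow_of_norm_lt_one`). [cite: NeukirchANT1999, Ch. II (5.5)] -/
theorem IsPrincipal.norm_one_sub_le_rpow {y : K} (hy : IsPrincipal y) :
    ‖1 - y‖ ≤ (p : ℝ) ^ (-(1 / (absRamificationIdx p K : ℝ))) :=
  norm_le_rpow_of_norm_lt_one p K hy

omit instK [IsUltrametricDist K] [ProperSpace K] in
/-- The exponent inequality: for `1 ≤ e ≤ p − 1`, `p^{−1/e} · p^{1/(p−1)} ≤ 1`
(`−1/e + 1/(p−1) ≤ 0`). [cite: Koblitz1984, Ch. IV §1] -/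
theorem rpow_neg_inv_mul_rpow_le_one {e : ℕ} (he0 : 0 < e) (he : e ≤ p - 1) :
    (p : ℝ) ^ (-(1 / (e : ℝ))) * (p : ℝ) ^ (1 / ((p : ℝ) - 1)) ≤ 1 := by
  have hp : p.Prime := Fact.out
  have hp1 : (1 : ℝ) ≤ p := by exact_mod_cast hp.one_lt.le
  have hp2 : 2 ≤ p := hp.two_le
  have he' : (e : ℝ) ≤ (p : ℝ) - 1 := by
    have : ((p - 1 : ℕ) : ℝ) = (p : ℝ) - 1 := by
      rw [Nat.cast_sub (by omega), Nat.cast_one]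
    rw [← this]; exact_mod_cast he
  have he0' : (0 : ℝ) < e := by exact_mod_cast he0
  have hpm1 : (0 : ℝ) < (p : ℝ) - 1 := by
    have : (2 : ℝ) ≤ p := by exact_mod_cast hp2
    linarith
  rw [← Real.rpow_add (by exact_mod_cast hp.pos)]
  apply Real.rpow_le_one_of_one_le_of_nonpos hp1
  have h1 : 1 / ((p : ℝ) - 1) ≤ 1 / (e : ℝ) := one_div_le_one_div_of_le he0' he'
  linarith

/-- `p^{−1/e} · p^{1/(p−1)} ≤ 1` for the absolute ramification index `e` of `K` when `e ≤ p − 1`.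
[cite: Koblitz1984, Ch. IV §1] -/
theorem rpow_absRamificationIdx_mul_rpow_le_one (he : absRamificationIdx p K ≤ p - 1) :
    (p : ℝ) ^ (-(1 / (absRamificationIdx p K : ℝ))) * (p : ℝ) ^ (1 / ((p : ℝ) - 1)) ≤ 1 :=
  rpow_neg_inv_mul_rpow_le_one p (absRamificationIdx_pos p K) he

/-- **`‖log_p u‖ ≤ p^{−1/e}` for every `u`, when `e ≤ p − 1`.** [cite: Koblitz1984, Ch. IV §1] -/
theorem norm_unitLog_le_rpow_of_absRamificationIdx_le (he : absRamificationIdx p K ≤ p - 1) (u : K) :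
    ‖unitLog u‖ ≤ (p : ℝ) ^ (-(1 / (absRamificationIdx p K : ℝ))) :=
  norm_unitLog_le_of_forall_isPrincipal p (rpow_absRamificationIdx_mul_rpow_le_one p he)
    (fun _ hy => hy.norm_one_sub_le_rpow p) u

/-- **`‖log_p u‖ < 1` for every `u`, when `e ≤ p − 1`**: the logarithm of a unit lies in the maximal
ideal. [cite: Koblitz1984, Ch. IV §1] -/
theorem norm_unitLog_lt_one_of_absRamificationIdx_le (he : absRamificationIdx p K ≤ p - 1) (u : K) :
    ‖unitLog u‖ < 1 :=
  norm_unitLog_lt_one_of_forall_isPrincipal p (rpow_absRamificationIdx_mul_rpow_le_one p he)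
    (fun _ hy => hy.norm_one_sub_le_rpow p) u

/-- **`log_p(𝒪_K^×) ⊆ 𝔪_K`** (`= ball 0 1`) when `e ≤ p − 1`. [cite: NeukirchANT1999, Ch. II (5.5)] -/
theorem logUnits_subset_ball_of_absRamificationIdx_le (he : absRamificationIdx p K ≤ p - 1) :
    logUnits K ⊆ ball (0 : K) 1 := by
  rintro _ ⟨u, -, rfl⟩
  rw [mem_ball, dist_zero_right]
  exact norm_unitLog_lt_one_of_absRamificationIdx_le p he u

/-- When `e ≤ p − 1`, no element of `log_p(𝒪_K^×)` is a unit. [cite: NeukirchANT1999, Ch. II (5.5)] -/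
theorem norm_ne_one_of_mem_logUnits (he : absRamificationIdx p K ≤ p - 1) {z : K}
    (hz : z ∈ logUnits K) : ‖z‖ ≠ 1 := by
  obtain ⟨u, -, rfl⟩ := hz
  exact (norm_unitLog_lt_one_of_absRamificationIdx_le p he u).ne

/-- When `e ≤ p − 1`, `log_p(𝒪_K^×) ∩ 𝒪_K^× = ∅`. [cite: NeukirchANT1999, Ch. II (5.5)] -/
theorem logUnits_inter_sphere_eq_empty (he : absRamificationIdx p K ≤ p - 1) :
    logUnits K ∩ {u : K | ‖u‖ = 1} = ∅ := by
  ext z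
  simp only [mem_inter_iff, mem_setOf_eq, mem_empty_iff_false, iff_false, not_and]
  exact fun hz => norm_ne_one_of_mem_logUnits p he hz

/-- When `e ≤ p − 1`, the **second iterate of `log_p` on units has empty image**: `log_p` applied to the
units lying in `log_p(𝒪_K^×)` (the domain of the next iterate of the log-link on units,
[IUTchIII] Rmk. 1.1.1 (i)) yields `∅`. [cite: NeukirchANT1999, Ch. II (5.5)] -/
theorem unitLog_image_logUnits_inter_sphere_eq_empty (he : absRamificationIdx p K ≤ p - 1) :
    unitLog '' (logUnits K ∩ {u : K | ‖u‖ = 1}) = ∅ := by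
  rw [logUnits_inter_sphere_eq_empty p he, image_empty]

/-- **The unramified case** (`e = 1`, any `p`, including `p = 2`: `log(ℤ_2^×) = 4ℤ_2 ⊆ 2ℤ_2`):
`‖log_p u‖ ≤ p⁻¹ < 1` for every `u`. [cite: NeukirchANT1999, Ch. II (5.5)] -/
theorem norm_unitLog_lt_one_of_absRamificationIdx_eq_one (he : absRamificationIdx p K = 1) (u : K) :
    ‖unitLog u‖ < 1 :=
  norm_unitLog_lt_one_of_absRamificationIdx_le p
    (by rw [he]; exact Nat.le_sub_one_of_lt (Fact.out : p.Prime).one_lt) u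

/-- The unramified case, quantitative: `‖log_p u‖ ≤ p⁻¹`. [cite: NeukirchANT1999, Ch. II (5.5)] -/
theorem norm_unitLog_le_inv_of_absRamificationIdx_eq_one (he : absRamificationIdx p K = 1) (u : K) :
    ‖unitLog u‖ ≤ (p : ℝ)⁻¹ := by
  have h := norm_unitLog_le_rpow_of_absRamificationIdx_le p
    (by rw [he]; exact Nat.le_sub_one_of_lt (Fact.out : p.Prime).one_lt) u
  rwa [he, Nat.cast_one, div_one, Real.rpow_neg_one] at h

end Literature.IUT.LogVolume

end
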